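import Literature.IUT.HodgeTheaters.PiAvatarThetaAmb
import Literature.IUT.HodgeTheaters.PiAvatarBaseKitLaws
import HarnessLib

/-!
# [IUTchI] Def 6.1 (ii)–(vii) at the initial Θ-data over the TRANSPORTER-OR-DEGENERATE ambient: the Θ-kit `baseKitThetaOfData`
# (D-JΘ1-1 (iv-b′); the D13 genuine kit `baseKitOfData` with `Amb v := ThetaAmb augGF (δ v).InPlay`; laws (α)(β))

S. Mochizuki, *Inter-universal Teichmüller theory I*, kurims manuscript (May 2020), Definition 6.1 (ii)–(vii) pp. 156–159, Example 6.3
(i)(ii) p. 161, Example 4.4 (i)(ii) pp. 106–107. ([IUTchI] Def 6.1 (ii) p.156) [claim: Mochizuki2012, status: disputed] (D-0012 claim key,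
series status DISPUTED — kernel definitions/theorems about abc-iut's OWN kit; nothing of the series is asserted; no side taken on
[IUTchIII] Cor. 3.12).

## What this file builds

abc-iut-L5-t4's genuine base kit `baseKitOfData CG hS hsurj bad arc δ : PMBaseKit l` (p444202) has `Amb v := (δ v).InPlay.FullSubcategory`,
a full subcategory of the orbit category, over which Example 4.4's evaluation-section binder is uninhabited at closed `Π_v̲` (abc-iut-w4-d054
p456090).  `baseKitThetaOfData` is the SAME kit with `Amb v := ThetaAmb D.augGF (δ v).InPlay` (abc-iut-L5-t4 `PiAvatarThetaAmb`): every
object, isomorphism, label structure, global object and `φ^{Θell}_{•,v̲}` is D13's, transported through the étale inclusion `ι` and the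
transport projection `π` (`ι ⋙ π = 𝟭`); the label map of an arbitrary morphism `X ⟶ †𝒟^{⊚±}` is that of its transport datum
(`labOfHom v f := labOfHomAmb (π.map f)`), so the naturality laws `labOfHom_pre/_post` are the landed `labOfHomAmb_pre/_post` (p443751).
Laws (α) `PhiEllSync` and (β) `NegCompatModel` are re-derived from the D13 proofs (p444756).  No new binder; nothing frozen is edited.
typed ≠ inhabited ≠ proved; binder ≠ fact.
-/

noncomputable section

namespace Literature.IUT.HodgeTheaters

open CategoryTheory

universe u v w

section BaseKitTheta

variable {F : Type u} {K : Type v} {Fbar : Type w} [Field F] [NumberField F] [Field K] [NumberField K]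
  [Algebra F K] [Field Fbar] [Algebra F Fbar] [Algebra K Fbar]
  {E : WeierstrassCurve F} [E.IsElliptic] {l : ℕ} {Pb : BadPlacePredicates K}
  (D : InitialThetaData F K Fbar E l Pb) (CG : D.geom.pe.CuspGalois) (hS : D.CuspClassesNormaliserStable) [Fact l.Prime]

namespace InitialThetaData

namespace LocalDatum

variable {D CG hS} (δ : D.LocalDatum CG hS)

/-- **The Θ-ambient at `v̲`**: the transporter-or-degenerate category on the objects in play (isomorphs of `𝒟_v̲`, `†𝒟_v̲^±`, `𝒟^{⊚±}`)
over the augmentation `Π_{C_F} ↠ G_F`. ([IUTchI] Def 6.1 (i) p.156) [claim: Mochizuki2012, status: disputed] -/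
abbrev AmbTheta : Type w := ThetaAmb D.augGF δ.InPlay

/-- The étale inclusion of the D13 ambient. ([IUTchI] Def 6.1 (i) p.156) [claim: Mochizuki2012, status: disputed] -/
abbrev ιTheta : δ.Amb ⥤ δ.AmbTheta := ThetaAmb.ι D.augGF δ.InPlay

/-- The transport projection onto the D13 ambient. ([IUTchI] Def 6.1 (i) p.156) [claim: Mochizuki2012, status: disputed] -/
abbrev πTheta : δ.AmbTheta ⥤ δ.Amb := ThetaAmb.π D.augGF δ.InPlay

/-- `𝒟_v̲` in the Θ-ambient. ([IUTchI] Def 4.1 (i) p.95) [claim: Mochizuki2012, status: disputed] -/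
abbrev modelTheta : δ.AmbTheta := δ.ιTheta.obj δ.model

/-- An object of the Θ-ambient is an isomorph of `𝒟_v̲` iff its underlying object is (isomorphisms are étale).
([IUTchI] Def 4.1 (i) p.95) [claim: Mochizuki2012, status: disputed] -/
theorem nonempty_iso_modelTheta_iff (X : δ.AmbTheta) : Nonempty (X ≅ δ.modelTheta) ↔ Nonempty (X.toFull ≅ δ.model) :=
  ThetaAmb.nonempty_iso_iff X.toFull δ.model

/-- The underlying Π-ambient isomorphism of an isomorphism of the Θ-ambient. ([IUTchI] Def 6.1 (iii) p.157) [claim: Mochizuki2012, status: disputed] -/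
abbrev isoDown {X Y : δ.AmbTheta} (φ : X ≅ Y) : X.toFull.obj ≅ Y.toFull.obj := (δ.InPlay).ι.mapIso (δ.πTheta.mapIso φ)

end LocalDatum

variable [(D.PiXund.subgroupOf D.PiXK).Normal] (hsurj : Function.Surjective D.toFlStarGlobal)
  {V : Type} [DecidableEq V] (bad arc : Finset V) (δ : V → D.LocalDatum CG hS)

/-- **THE GENUINE Θ-KIT OF [IUTchI] §6 AT THE INITIAL Θ-DATA** (Π-avatar, design D1 EMBEDDED, bad-place repair (iv-b′)): the interface
`PMBaseKit l` filled exactly as `baseKitOfData` but over the transporter-or-degenerate ambient `ThetaAmb augGF (δ v).InPlay` at every index;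
objects, isomorphisms, labels, global data and `φ^{Θell}` are D13's through `ι`/`π`; `labOfHom` reads the transport datum. Binders: those of
`baseKitOfData` (`CG`, `hS`, `[Normal]`, `hsurj`, the laws inside `δ`), none added. ([IUTchI] Def 6.1 (ii)-(vii) pp.156-159) [claim: Mochizuki2012, status: disputed] -/
def baseKitThetaOfData : PMBaseKit.{w} l where
  V := V
  bad := bad
  arc := arc
  Amb v := (δ v).AmbTheta
  model v := (δ v).modelTheta
  pmObj v X := (δ v).ιTheta.obj ((δ v).pmPair X.toFull).1
  toPM v X := (δ v).ιTheta.map ((δ v).pmPair X.toFull).2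
  LabCuspPM _ _ := D.geom.pe.Cusp
  labPM _ _ _ := D.gLabPMModel CG
  labMap := fun v {X} {Y} φ => (δ v).labMapAmb ((δ v).isoDown φ)
  labMap_refl v X := by
    change (δ v).labMapAmb (((δ v).InPlay).ι.mapIso ((δ v).πTheta.mapIso (Iso.refl X))) = _
    rw [Functor.mapIso_refl, Functor.mapIso_refl]
    exact (δ v).labMapAmb_refl _
  labMap_trans := fun v {X} {Y} {Z} φ ψ => by
    change (δ v).labMapAmb (((δ v).InPlay).ι.mapIso ((δ v).πTheta.mapIso (φ ≪≫ ψ))) = _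
    rw [Functor.mapIso_trans, Functor.mapIso_trans]
    exact (δ v).labMapAmb_trans _ _
  labMap_charts := fun v {X} {Y} hX _ φ e he =>
    (δ v).labMapAmb_trans_mem_charts ⟨(δ v).isoDown hX.some⟩ _ he
  exists_negative v X hX := by
    obtain ⟨α₀, hα₀⟩ := (δ v).exists_labMapAmb_ne_refl (X := X.toFull.obj) ⟨(δ v).isoDown hX.some⟩
    refine ⟨(δ v).ιTheta.mapIso (((δ v).InPlay).isoMk (X := X.toFull) (Y := X.toFull) α₀), ?_⟩
    have h : (δ v).isoDown ((δ v).ιTheta.mapIso (((δ v).InPlay).isoMk (X := X.toFull) (Y := X.toFull) α₀)) = α₀ :=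
      Iso.ext rfl
    change (δ v).labMapAmb ((δ v).isoDown ((δ v).ιTheta.mapIso (((δ v).InPlay).isoMk (X := X.toFull) (Y := X.toFull) α₀))) ≠ _
    rw [h]
    exact hα₀
  Glob := D.Glob
  gModel := D.gModel
  gIso := D.gIso
  GLab := D.GLabOf
  gLabMap := fun {G} {H} φ => D.gLabIso CG hS φ
  gLabMap_refl := D.gLabIso_refl CG hS
  gLabMap_trans := fun {G} {H} {J} φ ψ => D.gLabIso_trans CG hS φ ψ
  toFlStar := D.toFlStarOf
  toFlStar_surjective := D.toFlStarOf_surjective_of hsurj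
  gLabT := D.gLabTModel CG
  gChart₀ := D.gChart₀Model CG
  gChart₀_mem := D.gChart₀Model_mem_charts CG
  autCsp_le := D.autCsp_le_of CG hS
  gLab_range := D.gLab_range_of CG hS
  atV v := (δ v).atV ⋙ (δ v).ιTheta
  phiEll v := (δ v).ιTheta.map (δ v).phiEll
  labOfHom := fun v {X} {G} f => (δ v).labOfHomAmb (G := G) ((δ v).πTheta.map f).hom
  labOfHom_pre := fun v {X} {Y} {G} φ f => (δ v).labOfHomAmb_pre ((δ v).isoDown φ) ((δ v).πTheta.map f).hom
  labOfHom_post := fun v {X} {G} {H} f ψ => (δ v).labOfHomAmb_post X.toFull.property ((δ v).πTheta.map f).hom ψ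
  labOfHom_phiEll_bijective v := by
    change Function.Bijective ((δ v).labOfHomAmb (G := D.gModel) (δ v).phiEllAmb)
    rw [(δ v).labOfHomAmb_phiEllAmb]
    exact Function.bijective_id
  labOfHom_phiEll_charts v e he := by
    have key : ∀ (g : D.geom.pe.Cusp → D.geom.pe.Cusp) (hb : Function.Bijective g), g = id →
        (Equiv.ofBijective g hb).symm.trans e = e := by
      rintro g hb rfl
      ext x
      change e ((Equiv.ofBijective id hb).symm x) = e x
      congr 1
      exact Equiv.ofBijective_apply_symm_apply id hb x
    have hmem : e ∈ (D.gLabTModel CG).charts := (D.gLabPMModel CG).mem_toTorsor_charts he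
    convert hmem using 1
    exact key _ _ ((δ v).labOfHomAmb_phiEllAmb)

/-! ### Definitional readings -/

/-- The index type of the Θ-kit (definitional). ([IUTchI] Def 3.1 (e) p.62) [claim: Mochizuki2012, status: disputed] -/
@[simp] theorem baseKitThetaOfData_V : (D.baseKitThetaOfData CG hS hsurj bad arc δ).V = V := rfl

/-- The bad indices of the Θ-kit (definitional). ([IUTchI] Def 3.1 (e) p.62) [claim: Mochizuki2012, status: disputed] -/
@[simp] theorem baseKitThetaOfData_bad : (D.baseKitThetaOfData CG hS hsurj bad arc δ).bad = bad := rfl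

/-- The archimedean indices of the Θ-kit (definitional). ([IUTchI] Def 3.1 (e) p.62) [claim: Mochizuki2012, status: disputed] -/
@[simp] theorem baseKitThetaOfData_arc : (D.baseKitThetaOfData CG hS hsurj bad arc δ).arc = arc := rfl

/-- The ambient of the Θ-kit at `v` is the transporter-or-degenerate category over the objects in play (definitional).
([IUTchI] Def 6.1 (i) p.156) [claim: Mochizuki2012, status: disputed] -/
theorem baseKitThetaOfData_Amb (v : V) : (D.baseKitThetaOfData CG hS hsurj bad arc δ).Amb v = (δ v).AmbTheta := rfl

/-- The model of the Θ-kit at `v` is `ι(𝒟_v̲)` (definitional). ([IUTchI] Def 4.1 (i) p.95) [claim: Mochizuki2012, status: disputed] -/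
theorem baseKitThetaOfData_model (v : V) : (D.baseKitThetaOfData CG hS hsurj bad arc δ).model v = (δ v).modelTheta := rfl

/-- `φ^{Θell}_{•,v̲}` of the Θ-kit is `ι(φ^{Θell}_{•,v̲})` (definitional). ([IUTchI] Ex 6.3 (i) p.161) [claim: Mochizuki2012, status: disputed] -/
theorem baseKitThetaOfData_phiEll (v : V) :
    (D.baseKitThetaOfData CG hS hsurj bad arc δ).phiEll v = (δ v).ιTheta.map (δ v).phiEll := rfl

/-- The label map of a morphism of the Θ-kit is that of its transport datum (definitional).
([IUTchI] Prop 6.5 (i) p.163) [claim: Mochizuki2012, status: disputed] -/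
theorem baseKitThetaOfData_labOfHom (v : V) {X : (δ v).AmbTheta} {G : D.Glob} (f : X ⟶ ((δ v).atV ⋙ (δ v).ιTheta).obj G) :
    (D.baseKitThetaOfData CG hS hsurj bad arc δ).labOfHom v f = (δ v).labOfHomAmb (G := G) ((δ v).πTheta.map f).hom := rfl

/-- The label map of an isomorphism of the Θ-kit is that of its underlying Π-ambient isomorphism (definitional).
([IUTchI] Def 6.1 (iii) p.157) [claim: Mochizuki2012, status: disputed] -/
theorem baseKitThetaOfData_labMap (v : V) {X Y : (δ v).AmbTheta} (φ : X ≅ Y) :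
    (D.baseKitThetaOfData CG hS hsurj bad arc δ).labMap v φ = (δ v).labMapAmb ((δ v).isoDown φ) := rfl

/-- **The Θ-kit has a NON-invertible endomorphism of `𝒟_v̲` as soon as a degenerate outer endomorphism of `Π_v̲` is available** — the necessary
condition (O1) of abc-iut-w4-d054 p456090 for hosting Example 4.4, met where the D13 kit fails it at closed `Π_v̲`.
([IUTchI] Ex 4.4 (i) p.106) [claim: Mochizuki2012, status: disputed] -/
theorem exists_endo_not_isIso_baseKitThetaOfData (v : V) (φ : OuterHom (δ v).H (δ v).H) (hφ : φ.IsDegOver D.augGF) :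
    ∃ f : (D.baseKitThetaOfData CG hS hsurj bad arc δ).model v ⟶ (D.baseKitThetaOfData CG hS hsurj bad arc δ).model v, ¬ IsIso f :=
  ThetaAmb.exists_endo_not_isIso (aug := D.augGF) (δ v).model φ hφ

/-! ### (α) `PhiEllSync` and (β) `NegCompatModel` at the Θ-kit -/

/-- In the Θ-kit, pulling a chart of `𝒟_v̲` back along the (identity) label map of `φ^{Θell}_{•,v̲}` returns the chart.
([IUTchI] Ex 6.3 (i) p.161) [claim: Mochizuki2012, status: disputed] -/
theorem ofBijective_labOfHom_phiEll_symm_trans_theta (v : V) (e : D.geom.pe.Cusp ≃ ZMod l) :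
    (Equiv.ofBijective _ ((D.baseKitThetaOfData CG hS hsurj bad arc δ).labOfHom_phiEll_bijective v)).symm.trans e = e := by
  have key : ∀ (g : D.geom.pe.Cusp → D.geom.pe.Cusp) (hb : Function.Bijective g), g = id →
      (Equiv.ofBijective g hb).symm.trans e = e := by
    rintro g hb rfl
    ext x
    change e ((Equiv.ofBijective id hb).symm x) = e x
    congr 1
    exact Equiv.ofBijective_apply_symm_apply id hb x
  exact key _ _ ((δ v).labOfHomAmb_phiEllAmb)

/-- **(α) `PhiEllSync` HOLDS at the Θ-kit** (same label map of `φ^{Θell}` as D13). ([IUTchI] Ex 6.3 (i) p.161) [claim: Mochizuki2012, status: disputed] -/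
theorem phiEllSync_baseKitThetaOfData : PMBaseKit.Ex63.PhiEllSync (D.baseKitThetaOfData CG hS hsurj bad arc δ) := by
  intro v e he
  obtain ⟨ε, hε⟩ := (CG.mem_labPM_charts_iff D.geom.PiXbar_relIndex e).mp he
  exact ⟨ε, by rw [D.ofBijective_labOfHom_phiEll_symm_trans_theta CG hS hsurj bad arc δ v e, hε]; rfl⟩

/-- **(β) `NegCompatModel` HOLDS at the Θ-kit**: the D13 negative square `a ≫ φ^{Θell} = φ^{Θell} ≫ b` transported by `ι`.
([IUTchI] Ex 6.3 (ii) p.161) [claim: Mochizuki2012, status: disputed] -/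
theorem negCompatModel_baseKitThetaOfData : PMBaseKit.Ex63.NegCompatModel (D.baseKitThetaOfData CG hS hsurj bad arc δ) := by
  refine fun (v : V) => ?_
  obtain ⟨a, ha, b, hb, hsq⟩ := D.negCompatModel_baseKitOfData CG hS hsurj bad arc δ v
  refine ⟨(δ v).ιTheta.mapIso a, ?_, b, hb, ?_⟩
  · -- `labMap (ι a) = labMap a`
    have h : (δ v).isoDown ((δ v).ιTheta.mapIso a) = ((δ v).InPlay).ι.mapIso a := Iso.ext rfl
    change (δ v).labMapAmb ((δ v).isoDown ((δ v).ιTheta.mapIso a)) = _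
    rw [h]
    exact ha
  · -- the square, by functoriality of `ι`
    change (δ v).ιTheta.map a.hom ≫ (δ v).ιTheta.map (δ v).phiEll = (δ v).ιTheta.map (δ v).phiEll ≫ (δ v).ιTheta.map ((δ v).atV.map b.hom)
    rw [← Functor.map_comp, ← Functor.map_comp]
    exact congrArg _ hsq

end InitialThetaData

end BaseKitTheta

end Literature.IUT.HodgeTheaters
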